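/-
Origin: expansion seat `planner-pub-hodgecm-mc-theta-3-g9-0`, handover #S7 17:39Z md5 48a287d63c61 (173 l.; NEW additive Model leaf, imports Model.ThetaSpaceSat (#S1) + period-1's Model.ThetaSpaceTranslate (PKG); ns HodgeCM.Model.ThetaSpace: KTypeSituation.translateStrict (the k-conjugated situation keeping IsStrict), IsSaturated.translateStrict (hK : ∀ a ∈ KΓ', k a k⁻¹ ∈ KΓ), IsStrict.translateStrict, map_leftTranslateHom_forms_le_translateStrict, map_leftTranslateHom_thetaSpaceSatOf_le, exists_mem_thetaSpaceSatOf_coe_eq_leftTranslate, ENGINE exists_mem_thetaSpaceSatOf_apply_eq_leftTranslate (hγk : ιinf γ₁ * k ∈ P.ΓU) (hk : ∀ x, Commute k (ιinf x)) (hΔ' : γ₁ Δ' γ₁⁻¹ ⊆ Δ) (hK : k KΓ' k⁻¹ ⊆ KΓ) 𝓕 hF : ∃ F' ∈ thetaSpaceSatOf P ιinf Δ' κ₁ τ₁ KΓ' 𝓕, ∀ g, F' g = F (γ₁ * g). 0 Prop-defs / 0 records / nothing cited; axioms trio.) (`HOME/mc/pub-hodgecm-mc-theta-3-g9/lean/stage/HodgeCM/Model/ThetaSpaceSatTranslate.lean`,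 md5 48a287d6, 173 lines);
landed by the gen-13 packager (p-g13) in gate run 37 as `HodgeCM/Model/ThetaSpaceSatTranslate.lean` (packager comment re-wording per the RUN-32 precedent (gate audit (5) rejects the proof-placeholder tokens s-o-r-r-y / a-d-m-i-t anywhere in a source, comments included; owner consents STATUS l.12035/l.12037/l.12045, no objection by the cutoff): that one word inside the seat's provenance COMMENT at l.9 of the source re-spelt `proof-hole` (resp. `adm-token`); no Lean code byte touched).
-/
/-
Origin: CONSTRUCTION seat `planner-pub-hodgecm-mc-theta-3-g9-0` (unit pub-hodgecm-mc-theta-3-g9, gen 9 of mc-theta-3: theta supply /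
second-lift lane; (Θ-sat)/(X1)/(W1) RUN-37 pin-packet owner), 2026-08-19 — NEW ADDITIVE LEAF
`HodgeCM/Model/ThetaSpaceSatTranslate.lean` for the (Θ-sat) pin packet, item (E7) = (C-KfSat) (BINDER-TRIAGE §57, theta-3-g8
HANDOFF §7): the SATURATED analogue of mc-period-1's `Model/ThetaSpaceTranslate.lean` (b5c104a725f8).  Imports: this lineage's
`Model/ThetaSpaceSat` (draft 8d2d12959517: `IsSaturated`, `IsStrict`, `thetaSpaceSatOf`, `WeilPairData.kernelDatum_act_mul`) and
period-1's `Model/ThetaSpaceTranslate` (`KTypeSituation.translate`, vendored tree leaf (H⁵) `ThetaFormsRationalTranslate`).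
KERNEL: one construction (`KTypeSituation.translateStrict`, a `KTypeSituation`) + lemmas; 0 records, 0 `def … : Prop`, nothing
cited, 0 proof-hole; expected `#print axioms` ⊆ {propext, Classical.choice, Quot.sound}.  J-satK (1)(2) of mc-sanity-1-g8 (probe
`mc/pub-hodgecm-mc-sanity-1-g8/notes/JsatK.lean` 0ef8027b820c, STATUS 16:47:50Z / 16:50:16Z) adopted: saturation transports only to
`k⁻¹ KΓ k`; strictness transports only for the POINTWISE translated families — hence `translateStrict`.
-/
import Summits.HodgeConjecture.HodgeCM.Model.ThetaSpaceSat
import Summits.HodgeConjecture.HodgeCM.Model.ThetaSpaceTranslate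

/-!
# Saturated classical theta spaces under rational translation ((E7) = (C-KfSat))

`Model/ThetaSpaceTranslate` (mc-period-1) proves that left translation by `γ₁ ∈ G₁`, RATIONAL with respect to
`(ιinf, P.ΓU)` with finite-adelic corrector `k` (`ιinf γ₁ · k ∈ P.ΓU`, `k` centralising `ιinf (G₁)`), maps
`thetaSpaceOf … Δ …` into `thetaSpaceOf … Δ' …` whenever `γ₁ Δ' γ₁⁻¹ ⊆ Δ`, through the translated situation
`KTypeSituation.translate` (weight group `κₖ = k⁻¹ κ k`, families the `k⁻¹`-theta-translates).  For the SATURATED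
spaces `thetaSpaceSatOf … KΓ …` of `Model/ThetaSpaceSat` (the (Θ-sat) pin: strict situations saturated at `KΓ`)
two properties must ride along:

* saturation — `S` saturated at `KΓ` ⇒ the translate is saturated at every `KΓ'` with `k KΓ' k⁻¹ ⊆ KΓ`
  (`IsSaturated.translateStrict`).  Nothing better holds: the finite level MOVES under a translate, which is why the
  consumer below carries the finite-level clause `hK`, supplied at the pin by
  `Model/Junction/LevelSaturationConj.exists_level_le_forall_conj_mem_satLevelRegimeOf` (the level is allowed to shrink);
* strictness — transported for families translated ON THE NOSE, `j' = ω(k⁻¹, 1) ∘ j` (`IsStrict.translateStrict`, by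
  multiplicativity of the pair's Weil action, `WeilPairData.kernelDatum_act_mul`).  `KTypeSituation.translate` pins its
  families down only modulo theta series (`IsThetaTranslate`), so the saturated space uses the sibling situation
  `KTypeSituation.translateStrict` whose families are these pointwise translates (the witness of period-1's
  `hasThetaTranslates` is exactly this `j'`, so the (H⁵) engine applies verbatim).

**Result** (`map_leftTranslateHom_thetaSpaceSatOf_le`, `exists_mem_thetaSpaceSatOf_apply_eq_leftTranslate`): for
`ιinf γ₁ · k ∈ P.ΓU`, `k` centralising `ιinf (G₁)`, `γ₁ Δ' γ₁⁻¹ ⊆ Δ` AND `k KΓ' k⁻¹ ⊆ KΓ`, left translation by `γ₁`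
maps `thetaSpaceSatOf P ιinf Δ κ₁ τ₁ KΓ 𝓕` into `thetaSpaceSatOf P ιinf Δ' κ₁ τ₁ KΓ' 𝓕` — the theta-side input of
mc-glue-1's `Model/HStabDischarge` (E's binder `hStab`) under (Θ-sat).
-/

set_option autoImplicit false

noncomputable section

open MeasureTheory NumberField NumberField.mixedEmbedding IsDedekindDomain
open Literature.NumberTheory.Automorphic Literature.NumberTheory.Weil1964
open Literature.NumberTheory.Automorphic.WeightForms (restrictHom IsLevelCorrected IsWeightMatched leftTranslateHom
  isLevelCorrected_of_conj isWeightMatched_of_conj conj_mul_inv_eq conj_comp_apply)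
open HodgeCM.PerL34.Seesaw HodgeCM.PerL34.RationalCoset HodgeCM.PerL34.SupplyAdelic
open HodgeCM.Model.SupplyInstance HodgeCM.Model.SupplyResidual

namespace HodgeCM
namespace Model
namespace ThetaSpace

section SatTranslate

variable {K L : Type} [Field K] [NumberField K] [Field L] [NumberField L] [Algebra K L] [FiniteDimensional K L]
variable {J : Type} [Fintype J] {GU : Type} [Group GU] [TopologicalSpace GU] [IsTopologicalGroup GU]
  [LocallyCompactSpace GU]
variable {P : WeilPairData K L J GU} [CompactSpace (GU ⧸ P.ΓU)]
variable {G₁ K₁ W : Type} [Group G₁] [Group K₁] [AddCommGroup W] [Module ℂ W] [Module.IsReflexive ℂ W]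
variable {ιinf : G₁ →* GU} {Δ Δ' : Subgroup G₁} {κ₁ : K₁ →* G₁} {τ₁ : Representation ℂ K₁ W}

/-- **The strictly translated situation**: `KTypeSituation.translate` (same `K`-type data, weight group
`κₖ c = k⁻¹ κ(c) k`, level `Δ'` with `γ₁ Δ' γ₁⁻¹ ⊆ Δ`) with test families the POINTWISE `k⁻¹`-translates
`j' = ω(k⁻¹, 1) ∘ j` of those of `S`. -/
def KTypeSituation.translateStrict (S : KTypeSituation P ιinf Δ κ₁ τ₁) {γ₁ : G₁} {k : GU}
    (hγ : ιinf γ₁ * k ∈ P.ΓU) (hk : ∀ x : G₁, Commute k (ιinf x)) (hΔ' : ∀ δ' ∈ Δ', γ₁ * δ' * γ₁⁻¹ ∈ Δ) :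
    KTypeSituation P ιinf Δ' κ₁ τ₁ where
  Kc := S.Kc
  κ := (MulAut.conj k⁻¹).toMonoidHom.comp S.κ
  E := S.E
  σ := S.σ
  τ := S.τ
  ι := S.ι
  hι := S.hι
  η₁ := S.η₁
  hΔ := isLevelCorrected_of_conj ιinf S.hΔ hγ hk (conj_comp_apply (κ := S.κ) k) hΔ'
  hη := isWeightMatched_of_conj ιinf S.hη hk (conj_comp_apply (κ := S.κ) k)
  𝓙 := {j' | ∃ j ∈ S.𝓙, ∀ e : S.E, j'.1 e = P.kernelDatum.W.act (P.kernelDatum.s (k⁻¹, 1)) (j.1 e)}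

omit [CompactSpace (GU ⧸ P.ΓU)] [Module.IsReflexive ℂ W] in
/-- **J-satK (1): saturation transports to the conjugated index.**  If `S` is saturated at `KΓ` and
`k KΓ' k⁻¹ ⊆ KΓ`, the translate is saturated at `KΓ'` (`κₖ c = k⁻¹ κ(c) k = a` for `κ c = k a k⁻¹`). -/
theorem KTypeSituation.IsSaturated.translateStrict {S : KTypeSituation P ιinf Δ κ₁ τ₁} {KΓ KΓ' : Subgroup GU}
    (hS : S.IsSaturated KΓ) {γ₁ : G₁} {k : GU} (hγ : ιinf γ₁ * k ∈ P.ΓU) (hk : ∀ x : G₁, Commute k (ιinf x))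
    (hΔ' : ∀ δ' ∈ Δ', γ₁ * δ' * γ₁⁻¹ ∈ Δ) (hK : ∀ a ∈ KΓ', k * a * k⁻¹ ∈ KΓ) :
    (S.translateStrict hγ hk hΔ').IsSaturated KΓ' := by
  intro a ha
  obtain ⟨c, hc, hτ⟩ := hS (k * a * k⁻¹) (hK a ha)
  refine ⟨c, ?_, hτ⟩
  show (MulAut.conj k⁻¹) (S.κ c) = a
  rw [hc, MulAut.conj_apply, inv_inv, ← mul_assoc, ← mul_assoc, inv_mul_cancel, one_mul, inv_mul_cancel_right]

omit [CompactSpace (GU ⧸ P.ΓU)] [Module.IsReflexive ℂ W] in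
/-- **J-satK (2): strictness transports for the pointwise translated families** (the Weil action is
multiplicative: `ω(k⁻¹,1) ω(κ c,1) = ω(k⁻¹ κ(c) k, 1) ω(k⁻¹,1)`). -/
theorem KTypeSituation.IsStrict.translateStrict {S : KTypeSituation P ιinf Δ κ₁ τ₁} (hS : S.IsStrict)
    {γ₁ : G₁} {k : GU} (hγ : ιinf γ₁ * k ∈ P.ΓU) (hk : ∀ x : G₁, Commute k (ιinf x))
    (hΔ' : ∀ δ' ∈ Δ', γ₁ * δ' * γ₁⁻¹ ∈ Δ) :
    (S.translateStrict hγ hk hΔ').IsStrict := by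
  rintro j' ⟨j, hj, hje⟩ c e
  -- `hje` re-read at the translate's (definitionally equal) `K`-type, so that `rw` sees the goal's coercions
  have hje' : ∀ e' : (S.translateStrict hγ hk hΔ').E,
      j'.1 e' = P.kernelDatum.W.act (P.kernelDatum.s (k⁻¹, 1)) (j.1 e') := hje
  show j'.1 (S.σ c e) = P.kernelDatum.W.act (P.kernelDatum.s ((MulAut.conj k⁻¹) (S.κ c), 1)) (j'.1 e)
  rw [MulAut.conj_apply, inv_inv, hje' (S.σ c e), hje' e, hS j hj c e, ← WeilPairData.kernelDatum_act_mul,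
    ← WeilPairData.kernelDatum_act_mul, ← map_mul, ← map_mul, Prod.mk_mul_mk, Prod.mk_mul_mk, mul_one,
    mul_inv_cancel_right]

/-- **Left translation by a rational element maps a situation's restricted theta forms into those of the STRICTLY
translated situation** (period-1's `map_leftTranslateHom_forms_le` with the `hasThetaTranslates` witness
`j' := ω(k⁻¹, 1) ∘ j` kept on the nose). -/
theorem KTypeSituation.map_leftTranslateHom_forms_le_translateStrict (S : KTypeSituation P ιinf Δ κ₁ τ₁)
    {γ₁ : G₁} {k : GU} (hγ : ιinf γ₁ * k ∈ P.ΓU)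
    (hk : ∀ x : G₁, Commute k (ιinf x)) (hΔ' : ∀ δ' ∈ Δ', γ₁ * δ' * γ₁⁻¹ ∈ Δ)
    (𝓕 : Set C(relNormOneIdeles K L ⧸ relNormOneRat K L, ℂ)) :
    (S.forms 𝓕).map (leftTranslateHom γ₁ hΔ') ≤ (S.translateStrict hγ hk hΔ').forms 𝓕 := by
  unfold KTypeSituation.forms KTypeSituation.thetaForms
  refine ThetaKernelDatum.map_leftTranslateHom_map_restrictHom_thetaForms_le P.kernelDatum S.κ
    ((MulAut.conj k⁻¹).toMonoidHom.comp S.κ) (MonoidHom.id S.Kc) (probHaarRelNormOneQuot K L)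
    P.kernelDatum_thetaLinear S.ι S.hι S.hι ιinf hγ hk hΔ'
    (conj_mul_inv_eq (conj_comp_apply (κ := S.κ) k)) (fun _ => rfl) (fun _ => rfl) ?_ 𝓕
  intro j hj
  have hj' : P.kernelDatum.IsThetaTranslate k⁻¹ j.1
      ((P.ω (k⁻¹, 1) : piSchwartzBruhat K J →ₗ[ℂ] piSchwartzBruhat K J) ∘ₗ j.1) :=
    P.kernelDatum.isThetaTranslate_of_act fun _ => rfl
  exact ⟨⟨(P.ω (k⁻¹, 1) : piSchwartzBruhat K J →ₗ[ℂ] piSchwartzBruhat K J) ∘ₗ j.1,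
      hj'.isThetaEquivariant_of_conj P.kernelDatum j.2 (conj_mul_inv_eq (conj_comp_apply (κ := S.κ) k))
        (fun _ => rfl)⟩,
    ⟨j, hj, fun _ => rfl⟩, hj'⟩

/-- **The saturated classical theta spaces are stable under rational translation, level pair moved**: for
`ιinf γ₁ · k ∈ P.ΓU` (`k` centralising `ιinf (G₁)`), `γ₁ Δ' γ₁⁻¹ ⊆ Δ` and `k KΓ' k⁻¹ ⊆ KΓ`, left translation by
`γ₁` maps `thetaSpaceSatOf … Δ … KΓ …` into `thetaSpaceSatOf … Δ' … KΓ' …`. -/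
theorem map_leftTranslateHom_thetaSpaceSatOf_le {KΓ KΓ' : Subgroup GU} {γ₁ : G₁} {k : GU}
    (hγ : ιinf γ₁ * k ∈ P.ΓU) (hk : ∀ x : G₁, Commute k (ιinf x)) (hΔ' : ∀ δ' ∈ Δ', γ₁ * δ' * γ₁⁻¹ ∈ Δ)
    (hK : ∀ a ∈ KΓ', k * a * k⁻¹ ∈ KΓ) (𝓕 : Set C(relNormOneIdeles K L ⧸ relNormOneRat K L, ℂ)) :
    (thetaSpaceSatOf P ιinf Δ κ₁ τ₁ KΓ 𝓕).map (leftTranslateHom γ₁ hΔ') ≤ thetaSpaceSatOf P ιinf Δ' κ₁ τ₁ KΓ' 𝓕 := by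
  unfold thetaSpaceSatOf
  rw [Submodule.map_iSup]
  exact iSup_le fun S => (S.1.map_leftTranslateHom_forms_le_translateStrict hγ hk hΔ' 𝓕).trans
    (forms_le_thetaSpaceSatOf (S.1.translateStrict hγ hk hΔ') (S.2.1.translateStrict hγ hk hΔ' hK)
      (S.2.2.translateStrict hγ hk hΔ') 𝓕)

/-- **The same, one form at a time**: every `F` in the `KΓ`-saturated theta space of level `Δ` has
`F' : x ↦ F (γ₁ x)` in the `KΓ'`-saturated theta space of level `Δ'`. -/
theorem exists_mem_thetaSpaceSatOf_coe_eq_leftTranslate {KΓ KΓ' : Subgroup GU} {γ₁ : G₁} {k : GU}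
    (hγ : ιinf γ₁ * k ∈ P.ΓU) (hk : ∀ x : G₁, Commute k (ιinf x)) (hΔ' : ∀ δ' ∈ Δ', γ₁ * δ' * γ₁⁻¹ ∈ Δ)
    (hK : ∀ a ∈ KΓ', k * a * k⁻¹ ∈ KΓ) (𝓕 : Set C(relNormOneIdeles K L ⧸ relNormOneRat K L, ℂ))
    {F : weightForms Δ κ₁ τ₁} (hF : F ∈ thetaSpaceSatOf P ιinf Δ κ₁ τ₁ KΓ 𝓕) :
    ∃ F' ∈ thetaSpaceSatOf P ιinf Δ' κ₁ τ₁ KΓ' 𝓕, (F' : G₁ → W) = fun x => (F : G₁ → W) (γ₁ * x) :=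
  ⟨leftTranslateHom γ₁ hΔ' F,
    map_leftTranslateHom_thetaSpaceSatOf_le hγ hk hΔ' hK 𝓕 (Submodule.mem_map_of_mem hF), rfl⟩

/-- Pointwise form: `∀ x, F' x = F (γ₁ x)` (the shape consumed by `Model/HStabDischarge`). -/
theorem exists_mem_thetaSpaceSatOf_apply_eq_leftTranslate {KΓ KΓ' : Subgroup GU} {γ₁ : G₁} {k : GU}
    (hγ : ιinf γ₁ * k ∈ P.ΓU) (hk : ∀ x : G₁, Commute k (ιinf x)) (hΔ' : ∀ δ' ∈ Δ', γ₁ * δ' * γ₁⁻¹ ∈ Δ)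
    (hK : ∀ a ∈ KΓ', k * a * k⁻¹ ∈ KΓ) (𝓕 : Set C(relNormOneIdeles K L ⧸ relNormOneRat K L, ℂ))
    {F : weightForms Δ κ₁ τ₁} (hF : F ∈ thetaSpaceSatOf P ιinf Δ κ₁ τ₁ KΓ 𝓕) :
    ∃ F' ∈ thetaSpaceSatOf P ιinf Δ' κ₁ τ₁ KΓ' 𝓕, ∀ x : G₁, (F' : G₁ → W) x = (F : G₁ → W) (γ₁ * x) :=
  ⟨leftTranslateHom γ₁ hΔ' F,
    map_leftTranslateHom_thetaSpaceSatOf_le hγ hk hΔ' hK 𝓕 (Submodule.mem_map_of_mem hF), fun _ => rfl⟩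

end SatTranslate

end ThetaSpace
end Model
end HodgeCM

end
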